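import Summits.QuantumFields.BalabanUV.T4Continuum.Support.B13Represents

/-!
# NE5 ∕ U3 — row O1-e OVER AN ARBITRARY OPERATOR CARRIER (owner RULING R20, journal `CLAIMS.log` l.11032): the assembled step
# model of `B13Represents` with the operator slot `Op := OpDatum E` GENERALISED to any complex normed space `Op` (operator data
# ABSTRACT, read back into row O1-b's `OpDatum E` along a reading `rd : Op →L[ℂ] OpDatum E`), L01∕L02∕L03 by construction as before
# (claim table `t4/b2b-balaban-t4-ne5-p1/O1-CLAIM-TABLE-NE5-P1.md` row O1-e follower; design `B13StepDesign.md` v0.5 §8 R20)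

Cell `pub-balaban`, unit `b2b-balaban-t4-ne5-formalise-leaf-03` (NE5 formalisation swarm, LEAF PROVER 03, gen 6; INTENT
`CLAIMS.log` l.11190 under CLAIM RULE 1 — follower of leaf-09's row O1-e `B13Represents` p208313, custody leaf-09 by R20, written by
leaf-03 after the stated hold-off with hand-over offered).  Summits-side new work under the LEAN PLACEMENT RULE (cell modelling +
bookkeeping; NOT a Literature module).  HONEST FRAMING: rung (B)+1 of the FINITE-VOLUME T⁴ continuum programme — NOT infinite volume,
NOT a mass gap, NOT the Clay problem, NOT a proof of NE5 (NOT PRINTED in [Balaban1987RG1]–[Balaban1989LargeFieldII]; they print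
ε-UNIFORM bounds, never η-RATES).  HONEST DEPENDENCY (cell line, verbatim): continuum YM on T⁴ ⇐ BetaPertH ∧ nine spine estimates
(0/9 proved); BetaPertH ⇐ (D1) ∧ (D4) ∧ CAP+tail; G-an2-4 gates asym, D1 and NE2/3/4.

WHY (R20).  Every operator-species binder quantifying over an operator BALL in `Op := OpDatum E = ℓ^∞(E)` with `x`-INDEXED potential
species (`ActOpBound`∕`ActOpLip`, `ActOpFibre`∕`ActOpIntegral`, the (H-meas) clauses, `ActOpLineAnalyticOn`) is UNSATISFIABLE for cores
reading `o` at species indexed by the integration point (GAPS G-ne5p2-5).  The producers ∕ END faces are polymorphic in `Op`; what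
must change is the CARRIER.  `B13Represents.Assembly.step` hard-wires `Op := OpDatum E` through `opOf F raw`; this is its twin over `Op`:
* §1 `AssemblyOn C Op IOp Hist ι P J` (DATA, no inequality inside: term indexing, hard core, (2.14)-activity terms `act : P → J → Op →
  Hist → ℂ`, ABSTRACT operator data `opA : (ℕ → ℝ) → C.BgA → ℕ → Op` (run-A backgrounds) ∕ `opB`, the insertion datum, the margins) and
  `AssemblyOn.stepOn 𝔄 BHist : StepModel C Op Hist` — `Out := out 𝒯 inc act` (RULE R1), `opA` READ AT THE TRANSPORTED background (RULE R4),
  base := O1-f's self-centred budget box (`B13Base` is generic in `Op` — nothing of row O1-f is re-typed);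
* §2 `outA := recA`, `outB := recB`, **`representsB`** (L02, no hypothesis), **`representsA`** (L01, under the reading `TransportReads`),
  uniqueness, the structure binders and readings — leaf-09's §2 BY NAME, verbatim proofs;
* §3 L03 for the assembled model from the displayed run-B slice budget `SliceBudgetB`, the quoted level L06 and signs (`inBase`,
  `inBase_outB`, `baseBudget`, `boxInClass`) — leaf-09's §3, verbatim proofs;
* §4 the junctions: **W1 ALONG A READING** (R20: «W1 readings transfer along `rd`») — a reading `rd : Op →L[ℂ] OpDatum E` NORM-NON-
  CONTRACTING (`‖z‖ ≤ ‖rd z‖`; e.g. the isometric inclusion `Submodule.subtypeL` of a slot `M ≤ OpDatum E`) under which the operator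
  data ARE row O1-b's `opOf F rawA`∕`opOf F rawB`, with bounded raw suppliers and row NE2's weighted entrywise rate `c·θ^k` and the
  margin floor `r₀`, gives `OperatorRate (c∕r₀) θ` (`absOperatorRate_of_reading`, `operatorRate_of_reading`); W3 (`insScaleBoundLevel`∕
  `insScaleBound`), `out_eq_seriesOut`∕`outIsSeries`∕`termRep` as before;
* §5 CONSISTENCY: `ofAssembly 𝔄₀` views leaf-09's `Assembly` as an `AssemblyOn` with `Op := OpDatum E`, `opA := opOf F rawA`,
  `opB := opOf F rawB`; `stepOn_ofAssembly : (ofAssembly 𝔄₀).stepOn = 𝔄₀.step` and `outA∕outB` agree — by `rfl` (R20: «the old model =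
  `rd := id`»).
The instancer on Bałaban's carriers of record and the SUBMODULE specialisation of the slots of record (`Op := ↥M`, of record
`M := B13OpMeasurable.measOp …`) is the companion `Support/B13StepOfRecordSub.lean`.
WHAT IS *NOT* HERE (honest).  No estimate: W2 (both halves), row NE2's entrywise rate, the slice budgets (W3 level), the one-run
levels L05∕L06 and the numerics stay DISPLAYED binders of the END faces; nothing of the manuscripts under audit is asserted (cited for
KIND∕locus only).  `FlowStep.BetaPertH`, (B), (B^μ) do not occur.  0 sorry; no new axioms.
-/

noncomputable section

open scoped BigOperators
open Metric Set Finset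

namespace Summit.QuantumFields.BalabanUV.T4Continuum.B13RepresentsOn

open Literature.MathematicalPhysics.QuantumFieldTheory.Balaban1983to89.T4OutputRate (Carriers Functional DecayBound)
open Literature.MathematicalPhysics.QuantumFieldTheory.Balaban1983to89.T4InputCauchyRateData (StepModel tableA tableB sliceAt)
open Literature.MathematicalPhysics.QuantumFieldTheory.Balaban1983to89.T4InputCauchyRateSpecies (ballClass BaseBudget BoxInClass)
open Literature.MathematicalPhysics.QuantumFieldTheory.Balaban1983to89.T4InputCauchyRateTermwise (TermRep TermBound)
open Literature.MathematicalPhysics.QuantumFieldTheory.Balaban1983to89.T4OperatorRateLiaison (AbsOperatorRate operatorRate_of_absRate_floor)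
open Summit.QuantumFields.BalabanUV.T4Continuum.B13OpDatum (Format OpDatum)
open Summit.QuantumFields.BalabanUV.T4Continuum.B13OpDatumJunctions (opOf RawBounded WeightedEntrywiseRate norm_opOf_sub_le)
open Summit.QuantumFields.BalabanUV.T4Continuum.B13HistInsertion (InsDatum)
open Summit.QuantumFields.BalabanUV.T4Continuum.B13StepTermFamily (TermIndexing term out)
open Summit.QuantumFields.BalabanUV.T4Continuum.B13Base
  (HasBudgetBase OpBudgetB HistBudgetB selfCtr opBudgetB_selfCtr inBase_of_budgets baseBudget_of_hasBudgetBase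
    boxInClass_of_hasBudgetBase sum_pow_age_pred_le)
open Summit.QuantumFields.BalabanUV.T4Continuum.StepRecursion
  (InsBlindB ReadsTransported recA recB representsA_recA representsB_recB eq_recA_of_representsA eq_recB_of_representsB)
open Summit.QuantumFields.BalabanUV.T4Continuum.TermRepOfSeries (seriesOut OutIsSeries termRep_of_out_eq_seriesOut)
open Summit.QuantumFields.BalabanUV.T4Continuum.B13Represents (Assembly)

/-! ## §1 The assembly record over an arbitrary operator carrier and the assembled step model -/

/-- [folklore] DATA (no inequality inside): the PARAMETER RECORD of the assembled step OVER AN ARBITRARY OPERATOR CARRIER `Op`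
(R20) — O1-d's term indexing `𝒯`, hard core `inc` and (2.14)-activity terms `act` reading the operator input in `Op`; the two runs'
operator data ALREADY IN `Op` (run A's on RUN-A backgrounds, read at `C.transport U` by the model — RULE R4; how they are read back
into row O1-b's `OpDatum E` is a separate READING, §4); O1-c's insertion datum `D`; the margins (MODEL PARAMETERS, RULE R6). -/
structure AssemblyOn (C : Carriers) (Op IOp Hist ι P J : Type*) [NormedAddCommGroup Op] [NormedSpace ℂ Op]
    [NormedAddCommGroup Hist] [NormedSpace ℂ Hist] where
  /-- term indexing (row O1-d1) -/
  𝒯 : TermIndexing C ι P J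
  /-- hard-core incompatibility of polymers ((2.11) ζ = 0) -/
  inc : P → P → Prop
  /-- its decidability -/
  decInc : DecidableRel inc
  /-- the (2.14)-activity terms, read at the two-species input (operator input in `Op`) -/
  act : P → J → Op → Hist → ℂ
  /-- run A's operator data at a RUN-A background, in `Op` -/
  opA : (ℕ → ℝ) → C.BgA → ℕ → Op
  /-- run B's operator data, in `Op` -/
  opB : (ℕ → ℝ) → C.BgB → ℕ → Op
  /-- the insertion datum (row O1-c) -/
  D : InsDatum C IOp Hist
  /-- operator margin -/
  rOp : ℕ → ℝ
  /-- history margin -/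
  rHist : ℕ → ℝ
  rOp_pos : ∀ k, 0 < rOp k
  rHist_pos : ∀ k, 0 < rHist k

namespace AssemblyOn

variable {C : Carriers} {Op IOp Hist ι P J : Type*} [NormedAddCommGroup Op] [NormedSpace ℂ Op] [NormedAddCommGroup Hist]
  [NormedSpace ℂ Hist] (𝔄 : AssemblyOn C Op IOp Hist ι P J)

/-- [folklore] The hard core is decidable (field `decInc`). -/
instance instDecidableRelInc : DecidableRel 𝔄.inc := 𝔄.decInc

/-- [folklore] Run A's operator data READ AT THE TRANSPORTED BACKGROUND (how the carriers pair the runs, RULE R4). -/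
def opAt : (ℕ → ℝ) → C.BgB → ℕ → Op := fun g U k => 𝔄.opA g (C.transport U) k

/-- [folklore] The history reference of the class centre: the base part of the inserted history at run B's insertion-operator
datum ([II] (1.41), KIND). -/
def histRef : (ℕ → ℝ) → C.BgB → ℕ → Hist := fun g U k => 𝔄.D.base k (𝔄.D.insOpB g U k)

/-- [folklore] The RAW step model (placeholder base `univ`, replaced in `stepOn`): ONE output functional `out 𝒯 inc act` for both runs
(RULE R1), run A's operator data read at the transported background, insertions from row O1-c. -/
def raw : StepModel C Op Hist where
  Out := out 𝔄.𝒯 𝔄.inc 𝔄.act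
  opA := 𝔄.opAt
  opB := 𝔄.opB
  insA := 𝔄.D.insA
  insB := 𝔄.D.insB
  Base := fun _ _ _ => Set.univ
  rOp := 𝔄.rOp
  rHist := 𝔄.rHist
  rOp_pos := 𝔄.rOp_pos
  rHist_pos := 𝔄.rHist_pos

/-- [folklore] **THE ASSEMBLED STEP MODEL OVER `Op`** with the SELF-CENTRED BUDGET BOX of history radius `BHist` as admissible base
(row O1-f's dictionary `B13Base.selfCtr`∕`ballClass`, generic in `Op`: `Base k g U = B̄(opB g U k, 0) × B̄(histRef g U k, BHist k)`). -/
def stepOn (BHist : ℕ → ℝ) : StepModel C Op Hist :=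
  𝔄.raw.withBase (ballClass (selfCtr 𝔄.raw 𝔄.histRef) 0 BHist)

variable (BHist : ℕ → ℝ)

/-- [folklore] The fields of the assembled model (all `rfl`). -/
@[simp] theorem stepOn_Out : (𝔄.stepOn BHist).Out = out 𝔄.𝒯 𝔄.inc 𝔄.act := rfl
/-- [folklore] -/ @[simp] theorem stepOn_opA : (𝔄.stepOn BHist).opA = 𝔄.opAt := rfl
/-- [folklore] -/ @[simp] theorem stepOn_opB : (𝔄.stepOn BHist).opB = 𝔄.opB := rfl
/-- [folklore] -/ @[simp] theorem stepOn_insA : (𝔄.stepOn BHist).insA = 𝔄.D.insA := rfl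
/-- [folklore] -/ @[simp] theorem stepOn_insB : (𝔄.stepOn BHist).insB = 𝔄.D.insB := rfl
/-- [folklore] -/ @[simp] theorem stepOn_rOp : (𝔄.stepOn BHist).rOp = 𝔄.rOp := rfl
/-- [folklore] -/ @[simp] theorem stepOn_rHist : (𝔄.stepOn BHist).rHist = 𝔄.rHist := rfl
/-- [folklore] -/
theorem stepOn_base (k : ℕ) (g : ℕ → ℝ) (U : C.BgB) : (𝔄.stepOn BHist).Base k g U =
    closedBall (𝔄.opB g U k) 0 ×ˢ closedBall (𝔄.histRef g U k) (BHist k) := rfl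

/-- [folklore] The assembled model HAS the budget-box base about the self-centred centre (O1-f's `HasBudgetBase`, on the nose). -/
theorem hasBudgetBase : HasBudgetBase (𝔄.stepOn BHist) (selfCtr 𝔄.raw 𝔄.histRef) 0 BHist := fun _ _ _ => rfl

/-- [folklore] The centre of the installed base IS the assembled model's own run-B operators with the history reference. -/
theorem selfCtr_stepOn : selfCtr (𝔄.stepOn BHist) 𝔄.histRef = selfCtr 𝔄.raw 𝔄.histRef := rfl

/-! ## §2 The two runs' outputs DEFINED by the recursion; L01 ∕ L02 by construction; readings and structure binders -/

/-- [folklore] **RUN A's OUTPUT** of the assembled step over `Op`: the recursively defined functional `StepRecursion.recA` (RULE R1: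
[II] (2.13) p. 14 read as a definition; nothing printed is asserted). -/
def outA : Functional C C.BgA := recA (𝔄.stepOn BHist)

/-- [folklore] **RUN B's OUTPUT** of the assembled step over `Op`: `StepRecursion.recB`. -/
def outB : Functional C C.BgB := recB (𝔄.stepOn BHist)

/-- [folklore] READING: run A's insertion of the assembled model IS the datum's (`rfl`). -/
theorem readsA (W : Set (ℕ → ℝ)) : 𝔄.D.ReadsA (𝔄.stepOn BHist) W := fun _ _ _ _ _ => rfl

/-- [folklore] READING: run B's insertion of the assembled model IS the datum's (`rfl`). -/
theorem readsB (W : Set (ℕ → ℝ)) : 𝔄.D.ReadsB (𝔄.stepOn BHist) W := fun _ _ _ _ _ => rfl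

/-- [folklore] The three run-A structure binders of the END faces, BY CONSTRUCTION (row O1-c's lemmas by name). -/
theorem insAffine (W : Set (ℕ → ℝ)) : (𝔄.stepOn BHist).InsAffine W := InsDatum.insAffine_of_readsA (𝔄.readsA BHist W)
/-- [folklore] -/
theorem insBlind (W : Set (ℕ → ℝ)) : (𝔄.stepOn BHist).InsBlind W := InsDatum.insBlind_of_readsA (𝔄.readsA BHist W)
/-- [folklore] -/
theorem insHomog (W : Set (ℕ → ℝ)) : (𝔄.stepOn BHist).InsHomog W := InsDatum.insHomog_of_readsA (𝔄.readsA BHist W)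
/-- [folklore] The run-B twin (what `StepRecursion.representsB_recB` consumes). -/
theorem insBlindB (W : Set (ℕ → ℝ)) : InsBlindB (𝔄.stepOn BHist) W := InsDatum.insBlindB_of_readsB (𝔄.readsB BHist W)

/-- [folklore] **L02 BY CONSTRUCTION, ON EVERY WINDOW**: the recursively defined run-B output satisfies `RepresentsB`. -/
theorem representsB (W : Set (ℕ → ℝ)) : (𝔄.stepOn BHist).RepresentsB (𝔄.outB BHist) W :=
  representsB_recB (𝔄.insBlindB BHist W)

/-- [folklore] **L02 IS DEFINITIONAL**: any run-B functional satisfying `RepresentsB` agrees with `outB` on the window. -/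
theorem eq_outB {W : Set (ℕ → ℝ)} {EB : Functional C C.BgB} (hEB : (𝔄.stepOn BHist).RepresentsB EB W) {g : ℕ → ℝ}
    (hg : g ∈ W) (U : C.BgB) (X : C.Dom) : EB g U X = 𝔄.outB BHist g U X :=
  eq_recB_of_representsB (𝔄.insBlindB BHist W) hEB hg U X

/-- [folklore] HYPOTHESIS SHAPE (a READING, no estimate): run A's insertion-operator data depend on `U` only through `C.transport U`. -/
def TransportReads (W : Set (ℕ → ℝ)) : Prop :=
  ∀ g ∈ W, ∀ U U' : C.BgB, C.transport U = C.transport U' → ∀ k, 𝔄.D.insOpA g U k = 𝔄.D.insOpA g U' k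

/-- [folklore] The reading holds BY REWRITING when the insertion-operator data ARE a run-A datum read at the transported background
(RULE R4; stated as an identity of the data maps). -/
theorem transportReads_of_insOpA_eq {insOpAt : (ℕ → ℝ) → C.BgA → ℕ → IOp}
    (h : 𝔄.D.insOpA = fun g U k => insOpAt g (C.transport U) k) (W : Set (ℕ → ℝ)) : 𝔄.TransportReads W :=
  fun g _ U U' hUU' k => by simp only [h, hUU']

/-- [folklore] `StepRecursion.ReadsTransported` for the assembled model: the operator half BY CONSTRUCTION (`opAt`), the insertion
half from the reading (O1-c's `insA_eq_of_transport_eq`). -/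
theorem readsTransported {W : Set (ℕ → ℝ)} (hT : 𝔄.TransportReads W) : ReadsTransported (𝔄.stepOn BHist) W := by
  intro g hg U U' hUU'
  refine ⟨fun k => ?_, fun k t => InsDatum.insA_eq_of_transport_eq (𝔄.readsA BHist W) hT hg hUU' k t⟩
  change 𝔄.opAt g U k = 𝔄.opAt g U' k
  simp only [opAt, hUU']

/-- [folklore] **L01 BY CONSTRUCTION**: under the transport reading, the recursively defined run-A output satisfies `RepresentsA`. -/
theorem representsA {W : Set (ℕ → ℝ)} (hT : 𝔄.TransportReads W) : (𝔄.stepOn BHist).RepresentsA (𝔄.outA BHist) W :=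
  representsA_recA (𝔄.insBlind BHist W) (𝔄.readsTransported BHist hT)

/-- [folklore] **L01 IS DEFINITIONAL**: any run-A functional satisfying `RepresentsA` agrees with `outA` at transported backgrounds. -/
theorem eq_outA {W : Set (ℕ → ℝ)} (hT : 𝔄.TransportReads W) {EA : Functional C C.BgA}
    (hEA : (𝔄.stepOn BHist).RepresentsA EA W) {g : ℕ → ℝ} (hg : g ∈ W) (U : C.BgB) (X : C.Dom) :
    EA g (C.transport U) X = 𝔄.outA BHist g (C.transport U) X :=
  eq_recA_of_representsA (𝔄.insBlind BHist W) (𝔄.readsTransported BHist hT) hEA hg U X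

/-- [folklore] **MI-R (L01 ∧ L02) for the assembled step over `Op`**, in one line. -/
theorem represents {W : Set (ℕ → ℝ)} (hT : 𝔄.TransportReads W) :
    (𝔄.stepOn BHist).RepresentsA (𝔄.outA BHist) W ∧ (𝔄.stepOn BHist).RepresentsB (𝔄.outB BHist) W :=
  ⟨𝔄.representsA BHist hT, 𝔄.representsB BHist W⟩

/-- [folklore] `ReadsIns` (leaf L08r) BY CONSTRUCTION for the insertion-operator species of the datum (O1-c's `toInsOpModel`). -/
theorem readsIns [NormedAddCommGroup IOp] [NormedSpace ℂ IOp] (rI : ℕ → ℝ) (hrI : ∀ k, 0 < rI k) (W : Set (ℕ → ℝ)) :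
    (𝔄.D.toInsOpModel (𝔄.stepOn BHist) rI hrI).ReadsIns W :=
  InsDatum.readsIns_of_reads (𝔄.readsA BHist W) (𝔄.readsB BHist W)

/-! ## §3 Leaf L03 for the assembled model over `Op` from displayed one-run inputs (the (1.36) mechanism through the slices) -/

/-- [folklore] HYPOTHESIS SHAPE `SliceBudgetB κ c` — the RUN-B twin of row O1-c's age-free one-run W3 binder `InsDatum.SliceBudget`,
exactly as in `B13Represents.Assembly.SliceBudgetB` (a statement about the insertion datum and the history margin only — the
operator carrier does not enter).  NOT PRINTED as a statement about arbitrary single-scale tables — printed KIND: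
[Balaban1988RG2Cluster] (1.24) p. 7 ∕ (1.29) p. 8 ∕ (1.36) p. 9 at the inductive level; displayed, asserted nowhere. -/
def SliceBudgetB (W : Set (ℕ → ℝ)) (κ c : ℝ) : Prop :=
  ∀ k, ∀ g ∈ W, ∀ (U : C.BgB) (j : ℕ) (T : ℝ) (t : C.Dom → ℝ), j < k → 0 ≤ T →
    (∀ Y, C.scale Y ≠ j → t Y = 0) → (∀ Y, C.scale Y = j → |t Y| ≤ T * Real.exp (-(κ * C.d Y))) →
      ‖𝔄.D.slice k j (𝔄.D.insOpB g U k) t‖ ≤ 𝔄.rHist k * (c * T)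

variable {𝔄 BHist}

/-- [folklore] **RUN B's HISTORY BUDGET FROM THE QUOTED ONE-RUN LEVEL (leaf L06, [Balaban1987RG1] (1.18) p. 263 — SHAPE, c4) THROUGH
THE SLICES** — the (1.36) mechanism exactly as in `B13Represents.Assembly.norm_insB_sub_base_le`∕`histBudgetB` (a table of level `E₀·e^{−κd}`
below scale `k` is inserted within `E₀·rHist k·c·Σ_{j<k} ω^{k−1−j} ≤ E₀·rHist k·c∕(1 − ω)` of the base part: slices scale by scale, then the
age sum): `HistBudgetB` about the self-centred centre with radius `E₀·rHist·c∕(1 − ω)`.  The operator carrier does not enter. -/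
theorem histBudgetB {W : Set (ℕ → ℝ)} {κ c E₀ : ℝ} {EB : Functional C C.BgB} (hb : 𝔄.SliceBudgetB W κ c)
    (hdB : DecayBound EB W E₀ κ) (hE₀ : 0 ≤ E₀) (hc : 0 ≤ c) (hω : 0 ≤ 𝔄.D.ω) (hω1 : 𝔄.D.ω < 1) :
    HistBudgetB (𝔄.stepOn BHist) EB W (selfCtr 𝔄.raw 𝔄.histRef) fun k => E₀ * (𝔄.rHist k * (c / (1 - 𝔄.D.ω))) := by
  intro k g hg U
  change ‖𝔄.D.insB g U k (tableB EB g U) - 𝔄.histRef g U k‖ ≤ E₀ * (𝔄.rHist k * (c / (1 - 𝔄.D.ω)))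
  set t : C.Dom → ℝ := tableB EB g U
  have ht : ∀ Y, C.scale Y < k → |t Y| ≤ E₀ * Real.exp (-(κ * C.d Y)) := fun Y _ => hdB g hg U Y
  have hsplit : 𝔄.D.insB g U k t - 𝔄.histRef g U k =
      ∑ j ∈ range k, ((𝔄.D.ω ^ (k - 1 - j) : ℝ) : ℂ) • 𝔄.D.slice k j (𝔄.D.insOpB g U k) t := by
    simp only [InsDatum.insB, InsDatum.ins, histRef, add_sub_cancel_left]
  rw [hsplit]
  have hterm : ∀ j ∈ range k,
      ‖((𝔄.D.ω ^ (k - 1 - j) : ℝ) : ℂ) • 𝔄.D.slice k j (𝔄.D.insOpB g U k) t‖ ≤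
        𝔄.D.ω ^ (k - 1 - j) * (𝔄.rHist k * (c * E₀)) := by
    intro j hj
    have hjk : j < k := mem_range.1 hj
    rw [norm_smul, Complex.norm_real, Real.norm_eq_abs, abs_of_nonneg (pow_nonneg hω _),
      𝔄.D.slice_local k j _ t (sliceAt j t) fun _ hY =>
        (Literature.MathematicalPhysics.QuantumFieldTheory.Balaban1983to89.T4InputCauchyRateData.sliceAt_apply_of_eq hY).symm]
    refine mul_le_mul_of_nonneg_left ?_ (pow_nonneg hω _)
    refine hb k g hg U j E₀ (sliceAt j t) hjk hE₀ (fun _ hY => ?_) (fun Y hY => ?_)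
    · exact Literature.MathematicalPhysics.QuantumFieldTheory.Balaban1983to89.T4InputCauchyRateData.sliceAt_apply_of_ne hY
    · rw [Literature.MathematicalPhysics.QuantumFieldTheory.Balaban1983to89.T4InputCauchyRateData.sliceAt_apply_of_eq hY]
      exact ht Y (hY ▸ hjk)
  calc ‖∑ j ∈ range k, ((𝔄.D.ω ^ (k - 1 - j) : ℝ) : ℂ) • 𝔄.D.slice k j (𝔄.D.insOpB g U k) t‖
      ≤ ∑ j ∈ range k, 𝔄.D.ω ^ (k - 1 - j) * (𝔄.rHist k * (c * E₀)) := norm_sum_le_of_le _ hterm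
    _ = (∑ j ∈ range k, 𝔄.D.ω ^ (k - 1 - j)) * (𝔄.rHist k * (c * E₀)) := by rw [sum_mul]
    _ ≤ 1 / (1 - 𝔄.D.ω) * (𝔄.rHist k * (c * E₀)) :=
        mul_le_mul_of_nonneg_right (sum_pow_age_pred_le hω hω1 k)
          (mul_nonneg (𝔄.rHist_pos k).le (mul_nonneg hc hE₀))
    _ = E₀ * (𝔄.rHist k * (c / (1 - 𝔄.D.ω))) := by ring

variable (𝔄) in
/-- [folklore] The history radius of record: `E₀·rHist k·c∕(1 − ω)`. -/
def bHist (E₀ c : ℝ) : ℕ → ℝ := fun k => E₀ * (𝔄.rHist k * (c / (1 - 𝔄.D.ω)))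

/-- [folklore] **LEAF L03 FOR THE ASSEMBLED MODEL OVER `Op`** with base radius `bHist E₀ c`: `SliceBudgetB κ c ∧ DecayBound EB W E₀ κ`
(+ signs) ⟹ `InBase EB W` — the operator clause is EMPTY (budget `0` about run B's own operators, `B13Base.opBudgetB_selfCtr`). -/
theorem inBase {W : Set (ℕ → ℝ)} {κ c E₀ : ℝ} {EB : Functional C C.BgB} (hb : 𝔄.SliceBudgetB W κ c)
    (hdB : DecayBound EB W E₀ κ) (hE₀ : 0 ≤ E₀) (hc : 0 ≤ c) (hω : 0 ≤ 𝔄.D.ω) (hω1 : 𝔄.D.ω < 1) :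
    (𝔄.stepOn (𝔄.bHist E₀ c)).InBase EB W :=
  inBase_of_budgets (𝔄.hasBudgetBase _) (opBudgetB_selfCtr _ _ W) (histBudgetB hb hdB hE₀ hc hω hω1)

/-- [folklore] In particular L03 for the model's OWN run-B output `outB`. -/
theorem inBase_outB {W : Set (ℕ → ℝ)} {κ c E₀ : ℝ} (hb : 𝔄.SliceBudgetB W κ c)
    (hdB : DecayBound (𝔄.outB (𝔄.bHist E₀ c)) W E₀ κ) (hE₀ : 0 ≤ E₀) (hc : 0 ≤ c) (hω : 0 ≤ 𝔄.D.ω) (hω1 : 𝔄.D.ω < 1) :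
    (𝔄.stepOn (𝔄.bHist E₀ c)).InBase (𝔄.outB (𝔄.bHist E₀ c)) W :=
  inBase hb hdB hE₀ hc hω hω1

variable (𝔄) in
/-- [folklore] `BaseBudget` of the budget∕secant END faces BY CONSTRUCTION (O1-f by name). -/
theorem baseBudget (BHist : ℕ → ℝ) (W : Set (ℕ → ℝ)) :
    BaseBudget (𝔄.stepOn BHist) W (selfCtr 𝔄.raw 𝔄.histRef) 0 BHist :=
  baseBudget_of_hasBudgetBase (𝔄.hasBudgetBase BHist) W

variable (𝔄) in
/-- [folklore] ROOM ⟹ SLACK: class radii `ROp k ≥ rOp k` and `RHist k ≥ BHist k + rHist k` put the two-margin box of every base point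
inside `ballClass (selfCtr …) ROp RHist` — the class (now a family of subsets of `Op × Hist`) on which the wall O2 is DISPLAYED. -/
theorem boxInClass (BHist : ℕ → ℝ) (W : Set (ℕ → ℝ)) {ROp RHist : ℕ → ℝ} (hOp : ∀ k, 𝔄.rOp k ≤ ROp k)
    (hHist : ∀ k, BHist k + 𝔄.rHist k ≤ RHist k) :
    BoxInClass (𝔄.stepOn BHist) (ballClass (selfCtr 𝔄.raw 𝔄.histRef) ROp RHist) W :=
  boxInClass_of_hasBudgetBase (𝔄.hasBudgetBase BHist) W (fun k => by rw [Pi.zero_apply, zero_add]; exact hOp k) hHist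

/-! ## §4 The junctions the END faces read: W1 ALONG A READING (R20), W3, the series identification -/

/-- [folklore] **W1 ALONG A READING, ABSOLUTE CURRENCY** (R20: «W1's raw-species rates∕readings transfer along `rd` verbatim — they
are statements about `rd o`»).  A reading `rd : Op →L[ℂ] OpDatum E` that does not contract norms (`‖z‖ ≤ ‖rd z‖`; the isometric
inclusion `Submodule.subtypeL` of a slot `M ≤ OpDatum E` is the case of record), under which the model's operator data ARE row O1-b's
`opOf F rawA` (run-A backgrounds) ∕ `opOf F rawB`, with bounded raw suppliers on the window and row NE2's weighted entrywise two-run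
rate `c·θ^k` between run A's species AT THE TRANSPORTED BACKGROUND and run B's (DISPLAYED, NOT PRINTED) ⟹ the liaison's
`AbsOperatorRate (stepOn BHist) W c θ` in the norm of `Op`. -/
theorem absOperatorRate_of_reading {E : Type*} (rd : Op →L[ℂ] OpDatum E) (hrd : ∀ z : Op, ‖z‖ ≤ ‖rd z‖)
    {F : ℕ → Format E} {rawA : (ℕ → ℝ) → C.BgA → ℕ → E → ℂ} {rawB : (ℕ → ℝ) → C.BgB → ℕ → E → ℂ}
    (hA : ∀ g V k, rd (𝔄.opA g V k) = opOf F rawA g V k) (hB : ∀ g U k, rd (𝔄.opB g U k) = opOf F rawB g U k)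
    {W : Set (ℕ → ℝ)} {c θ : ℝ} (hRA : RawBounded F (fun g U k => rawA g (C.transport U) k) W) (hRB : RawBounded F rawB W)
    (h : WeightedEntrywiseRate F (fun g U k => rawA g (C.transport U) k) rawB W c fun k => θ ^ k) (hc : 0 ≤ c) (hθ : 0 ≤ θ) :
    AbsOperatorRate (𝔄.stepOn BHist) W c θ := by
  intro k g hg U
  change ‖𝔄.opAt g U k - 𝔄.opB g U k‖ ≤ c * θ ^ k
  refine (hrd _).trans ?_
  rw [map_sub, opAt, hA, hB]
  exact norm_opOf_sub_le hRA hRB h hc (fun k => pow_nonneg hθ k) k hg U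

/-- [folklore] **W1 (leaf L07) ALONG A READING, IN MARGIN UNITS**: the same with an [I]-type margin floor `r₀ ≤ rOp k` ⟹
`OperatorRate W (c∕r₀) θ` (the liaison's `operatorRate_of_absRate_floor` BY NAME).  The rate is DISPLAYED (row NE2's residual). -/
theorem operatorRate_of_reading {E : Type*} (rd : Op →L[ℂ] OpDatum E) (hrd : ∀ z : Op, ‖z‖ ≤ ‖rd z‖)
    {F : ℕ → Format E} {rawA : (ℕ → ℝ) → C.BgA → ℕ → E → ℂ} {rawB : (ℕ → ℝ) → C.BgB → ℕ → E → ℂ}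
    (hA : ∀ g V k, rd (𝔄.opA g V k) = opOf F rawA g V k) (hB : ∀ g U k, rd (𝔄.opB g U k) = opOf F rawB g U k)
    {W : Set (ℕ → ℝ)} {c θ r₀ : ℝ} (hRA : RawBounded F (fun g U k => rawA g (C.transport U) k) W) (hRB : RawBounded F rawB W)
    (h : WeightedEntrywiseRate F (fun g U k => rawA g (C.transport U) k) rawB W c fun k => θ ^ k) (hc : 0 ≤ c) (hθ : 0 ≤ θ)
    (hfl : ∀ k, r₀ ≤ 𝔄.rOp k) (hr₀ : 0 < r₀) : (𝔄.stepOn BHist).OperatorRate W (c / r₀) θ :=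
  operatorRate_of_absRate_floor (𝔄.stepOn BHist) (absOperatorRate_of_reading rd hrd hA hB hRA hRB h hc hθ) hfl hr₀ hc hθ

/-- [folklore] **W3 at every level (leaf L09) from row O1-c's age-free binder** (`insScaleBoundLevel_of_sliceBudget` by name). -/
theorem insScaleBoundLevel {W : Set (ℕ → ℝ)} {κ c : ℝ} (hb : 𝔄.D.SliceBudget (𝔄.stepOn BHist) W κ c) (hω : 0 ≤ 𝔄.D.ω) :
    (𝔄.stepOn BHist).InsScaleBoundLevel W κ c 𝔄.D.ω :=
  InsDatum.insScaleBoundLevel_of_sliceBudget (𝔄.readsA BHist W) hb hω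

/-- [folklore] … and at a reference level `E₁ ≥ 0` (the END faces' `InsScaleBound`). -/
theorem insScaleBound {W : Set (ℕ → ℝ)} {κ c E₁ : ℝ} (hb : 𝔄.D.SliceBudget (𝔄.stepOn BHist) W κ c) (hω : 0 ≤ 𝔄.D.ω)
    (hE₁ : 0 ≤ E₁) : (𝔄.stepOn BHist).InsScaleBound W κ E₁ c 𝔄.D.ω :=
  fun k g hg U t j hj hsupp hbd => insScaleBoundLevel hb hω k g hg U t j E₁ hj hE₁ hsupp hbd

/-- [folklore] The output of the assembled model IS the series of its Ursell terms (d3's identification, `rfl`). -/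
theorem out_eq_seriesOut : (𝔄.stepOn BHist).Out = seriesOut (term 𝔄.𝒯 𝔄.inc 𝔄.act) := rfl

/-- [folklore] `OutIsSeries` for the assembled model over `Op`. -/
theorem outIsSeries : OutIsSeries (𝔄.stepOn BHist) (term 𝔄.𝒯 𝔄.inc 𝔄.act) := fun _ _ _ _ => rfl

/-- [folklore] **d3-ii — `TermRep` FOR THE ASSEMBLED MODEL OVER `Op` on any class, from the DISPLAYED termwise majorant** (printed
SUPPORT: [II] Lemma 3 (2.38) p. 20, (2.41) p. 21 — locators only; asserted nowhere). -/
theorem termRep {K : ℕ → (ℕ → ℝ) → C.BgB → Set (Op × Hist)} {W : Set (ℕ → ℝ)} {κ : ℝ} {a : ℕ → ι → ℝ}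
    (hbd : TermBound K (term 𝔄.𝒯 𝔄.inc 𝔄.act) W κ a) (ha : ∀ k, Summable (a k)) :
    TermRep (𝔄.stepOn BHist) K (term 𝔄.𝒯 𝔄.inc 𝔄.act) W :=
  termRep_of_out_eq_seriesOut out_eq_seriesOut hbd ha

end AssemblyOn

/-! ## §5 Consistency: leaf-09's assembly IS the `Op := OpDatum E` instance (R20: «the old model = `rd := id`») -/

section OfAssembly

variable {C : Carriers} {E IOp Hist ι P J : Type*} [NormedAddCommGroup Hist] [NormedSpace ℂ Hist]
  (𝔄₀ : Assembly C E IOp Hist ι P J)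

/-- [folklore] Leaf-09's assembly record viewed over the carrier `Op := OpDatum E`: operator data `opOf F rawA` ∕ `opOf F rawB`. -/
def ofAssembly : AssemblyOn C (OpDatum E) IOp Hist ι P J where
  𝒯 := 𝔄₀.𝒯
  inc := 𝔄₀.inc
  decInc := 𝔄₀.decInc
  act := 𝔄₀.act
  opA := opOf 𝔄₀.F 𝔄₀.rawA
  opB := opOf 𝔄₀.F 𝔄₀.rawB
  D := 𝔄₀.D
  rOp := 𝔄₀.rOp
  rHist := 𝔄₀.rHist
  rOp_pos := 𝔄₀.rOp_pos
  rHist_pos := 𝔄₀.rHist_pos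

/-- [folklore] **THE OLD MODEL IS THE `OpDatum E` INSTANCE**: the two assembled step models coincide (`rfl`; the identity reading
`rd := ContinuousLinearMap.id` satisfies §4's hypotheses with `rfl`, `le_rfl`). -/
theorem stepOn_ofAssembly (BHist : ℕ → ℝ) : (ofAssembly 𝔄₀).stepOn BHist = 𝔄₀.step BHist := rfl

/-- [folklore] … with the same history radius of record and the same outputs (`rfl`). -/
theorem bHist_ofAssembly (E₀ c : ℝ) : (ofAssembly 𝔄₀).bHist E₀ c = 𝔄₀.bHist E₀ c := rfl
/-- [folklore] -/
theorem outA_ofAssembly (BHist : ℕ → ℝ) : (ofAssembly 𝔄₀).outA BHist = 𝔄₀.outA BHist := rfl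
/-- [folklore] -/
theorem outB_ofAssembly (BHist : ℕ → ℝ) : (ofAssembly 𝔄₀).outB BHist = 𝔄₀.outB BHist := rfl

end OfAssembly

end Summit.QuantumFields.BalabanUV.T4Continuum.B13RepresentsOn

end
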